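import Literature.AlgebraicGeometry.Motives.FaltingsECEndCoreMultiplicativeAboveEllProofs
import Literature.AlgebraicGeometry.Motives.FaltingsECEndCoreOrdinaryPotentialProofs
import Literature.NumberTheory.EllipticCurves.KernelReductionTateFormDoublingProofs
import HarnessLib

/-!
# Faltings 1983, Satz 4 for an elliptic curve: non-integral `j` for every prime `ℓ`, the case
# `ℓ = 2` at an ordinary place above `2`, and the frontier of the core fact

Theorem-only sequel of `FaltingsECEndCoreMultiplicativeAboveEllProofs` (`ord_v(j) < 0` at
`v ∣ ℓ`, `ℓ` odd), `FaltingsECEndCoreOrdinaryPotentialProofs` and the elliptic-curve files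
`KernelReductionTateFormDoublingProofs` / `KernelReductionOrdinaryTwoProofs`.

* **The rank lemma with slack** (`not_surjective_rationalGaloisRepTate_sub_one_of_le_pow_add`):
  if `#((σ - 1) E[ℓᵐ]) ≤ ℓ^{m + d}` for all `m` (a fixed `d`), then `ρ_ℓ(σ) - 1` is not
  surjective on `V_ℓ E`; and the generic step
  `exists_eq_smul_one_of_equivariant_of_card_map_smul_sub_le_pow_add` (with `χ_ℓ(σ) ≠ 1`, `σ`
  fixes exactly a line, and a plane representation without stable lines one of whose elements
  fixes exactly a line has scalar commutant).
* **Non-integral `j`, every prime `ℓ` (including `ℓ = 2`)**: the core statement at a place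
  `v ∣ ℓ` with `ord_v(j) < 0` (`…_of_one_lt_valuation_j_of_mem_asIdeal`, through
  `WeierstrassCurve.exists_cyclotomicCharacter_ne_one_card_map_smul_sub_le_pow_add_two_of_one_lt_valuation_j`:
  on the Tate form the *doubles* of `(τ - 1) E[ℓᵐ]` lie in the kernel of reduction), hence at
  any finite place with `ord_v(j) < 0` (`…_of_nonintegral_j`, with `FaltingsECEndCoreCasesProofs`
  for `v ∤ ℓ`); the named fact `exists_eq_smul_one_of_equivariant_of_not_hasRationalCM W ℓ`,
  Faltings' Satz 4, the subspace statement for `E × E` and Korollar 1 for `(E, E)` follow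
  unconditionally for every curve with non-integral `j` and every `ℓ` — Serre's theorem (1968,
  IV.2.2 with A.1) for curves with non-integral invariant.
* **`ℓ = 2` at a place of good ordinary reduction above `2`** (the Hasse invariant in
  characteristic `2` is `a₁`): the same package (`…_of_isUnit_a₁`, also `…_of_extension` over a
  finite `L/K`), after Serre 1968, IV.2.2 with A.2.2.
* **The frontier** (`exists_eq_smul_one_of_equivariant_of_not_hasRationalCM_of_residual_supersingular`):
  over a number field and for every prime `ℓ` the named fact now reduces to the case `¬ HasCM`,
  `K` totally imaginary, `j(E) ∈ 𝓞_K` (potentially good reduction everywhere), and no finite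
  extension `L/K` has a place `w ∣ ℓ` carrying a good model of `E_L` with unit Hasse invariant
  (`a₁` for `ℓ = 2`, `A_ℓ` for odd `ℓ`) — i.e. `E` has potentially good *supersingular*
  reduction at every place above `ℓ`: the case where Serre's theorem needs the Hodge–Tate
  decomposition (1968, III and IV.A.2.3), or Faltings' Finiteness I.

## References

* [SerreAbelianLadic1968] J.-P. Serre, *Abelian ℓ-adic representations and elliptic curves*
  (1968), Ch. IV §2.2, A.1.1–A.1.3, A.2.2–A.2.4.
* [Faltings1983Endlichkeit] G. Faltings, Invent. Math. 73 (1983), §5 Satz 4 and Korollar 1.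
* [SilvermanAEC2009] J. H. Silverman, *The Arithmetic of Elliptic Curves*, 2nd ed., III.6.4,
  III.8.3.
-/

noncomputable section

open scoped TensorProduct

universe u

namespace Literature.AlgebraicGeometry.Motives

open WeierstrassCurve Module Literature.NumberTheory.EllipticCurves
  Literature.NumberTheory.GaloisRepresentations Field IsDedekindDomain
open scoped NumberField

variable {K : Type u} [Field K] (W : WeierstrassCurve K) (ℓ : ℕ) [hℓ : Fact ℓ.Prime]

/-! ## The rank lemma with slack -/

/-- **If `#((σ - 1) E[ℓᵐ]) ≤ ℓ^{m + d}` for all `m`, then `ρ_ℓ(σ) - 1` is not surjective on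
`V_ℓ E`** (`d` fixed).  As `not_surjective_rationalGaloisRepTate_sub_one` (`d = 0`): otherwise
`(T_ℓ(σ) - 1)(T_ℓ E) ⊇ ℓᵏ T_ℓ E` for some `k`, so `ℓᵏ E[ℓᵐ] ⊆ (σ - 1) E[ℓᵐ]` and
`ℓ^{2m - 2k} ≤ ℓ^{m + d}`, false for `m = 2k + d + 1`.
[cite: SerreAbelianLadic1968, IV A.2.2] [cite: SilvermanAEC2009, Cor. III.6.4(b)] -/
theorem not_surjective_rationalGaloisRepTate_sub_one_of_le_pow_add [W.IsElliptic]
    (hℓK : (ℓ : K) ≠ 0) (σ : Field.absoluteGaloisGroup K) (d : ℕ)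
    (hcard : ∀ m : ℕ, Nat.card ((geomTorsion W ((ℓ ^ m : ℕ) : ℤ)).map
      (DistribSMul.toAddMonoidHom (geomPoints W) σ - AddMonoidHom.id (geomPoints W))) ≤
        ℓ ^ (m + d)) :
    ¬ Function.Surjective
      (rationalGaloisRepTate W ℓ σ - 1 : Module.End ℚ_[ℓ] (W.rationalTateModule ℓ)) := by
  intro hsurj
  haveI := module_finite_tateModule_holds W ℓ
  set fT : W.tateModule ℓ →ₗ[ℤ_[ℓ]] W.tateModule ℓ := W.galoisRepTate ℓ σ - 1 with hfT
  have hfT_apply : ∀ x, fT x = W.galoisRepTate ℓ σ x - x := fun x ↦ rfl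
  -- Step 1: every `x ∈ T_ℓ E` has a non-zero multiple in the image of `T_ℓ(σ) - 1`
  have step1 : ∀ x : W.tateModule ℓ, ∃ N : ℤ_[ℓ], N ≠ 0 ∧ N • x ∈ LinearMap.range fT := by
    intro x
    obtain ⟨z, hz⟩ := hsurj (TateModule.toRational ℓ x)
    obtain ⟨N, hN, y, hy⟩ := RationalTateModule.exists_smul_eq_toRational z
    refine ⟨N, hN, y, ?_⟩
    apply TateModule.toRational_injective (p := ℓ)
    rw [hfT_apply, ← rationalGaloisRepTate_sub_one_toRational, ← hy, map_smul, hz,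
      map_smul]
    exact algebraMap_smul ℚ_[ℓ] N _
  -- Step 2: a single `N ≠ 0` with `N • T_ℓ E ⊆ range`
  obtain ⟨S, hS⟩ := Module.finite_def.mp ‹Module.Finite ℤ_[ℓ] (W.tateModule ℓ)›
  classical
  choose Nf hNf hNmem using step1
  set N : ℤ_[ℓ] := ∏ s ∈ S, Nf s with hN
  have hN0 : N ≠ 0 := Finset.prod_ne_zero_iff.mpr fun s _ ↦ hNf s
  have step2 : ∀ x : W.tateModule ℓ, N • x ∈ LinearMap.range fT := by
    have hgen : ∀ x ∈ Submodule.span ℤ_[ℓ] (S : Set (W.tateModule ℓ)),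
        N • x ∈ LinearMap.range fT := by
      intro x hx
      induction hx using Submodule.span_induction with
      | mem s hs =>
        obtain ⟨M, hM⟩ : Nf s ∣ N := Finset.dvd_prod_of_mem _ hs
        rw [hM, mul_comm, mul_smul]
        exact Submodule.smul_mem _ _ (hNmem s)
      | zero => rw [smul_zero]; exact Submodule.zero_mem _
      | add x y _ _ hx hy => rw [smul_add]; exact Submodule.add_mem _ hx hy
      | smul a x _ hx => rw [smul_comm]; exact Submodule.smul_mem _ _ hx
    intro x
    exact hgen x (by rw [hS]; exact Submodule.mem_top)
  -- Step 3: `N = u ℓᵏ`, so `ℓᵏ T_ℓ E ⊆ range`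
  set k : ℕ := N.valuation with hk
  have step3 : ∀ x : W.tateModule ℓ, (ℓ : ℤ_[ℓ]) ^ k • x ∈ LinearMap.range fT := by
    intro x
    have hu := PadicInt.unitCoeff_spec hN0
    have hx := step2 ((PadicInt.unitCoeff hN0)⁻¹.val • x)
    have hNu : N * (PadicInt.unitCoeff hN0)⁻¹.val = (ℓ : ℤ_[ℓ]) ^ k := by
      conv_lhs => arg 1; rw [hu]
      rw [mul_comm, ← mul_assoc, Units.inv_mul, one_mul, hk]
    rw [← mul_smul, hNu] at hx
    exact hx
  -- Step 4: at level `m = 2k + d + 1`, `ℓᵏ E[ℓᵐ] ⊆ (σ - 1) E[ℓᵐ]`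
  set m : ℕ := 2 * k + d + 1 with hm
  set H := (geomTorsion W ((ℓ ^ m : ℕ) : ℤ)).map
    (DistribSMul.toAddMonoidHom (geomPoints W) σ - AddMonoidHom.id (geomPoints W)) with hH
  have step4 : ∀ P ∈ geomTorsion W ((ℓ ^ m : ℕ) : ℤ), ℓ ^ k • P ∈ H := by
    intro P hP
    obtain ⟨a, ha⟩ := proj_surjective_of_isAlgClosed_holds W ℓ m hP
    obtain ⟨b, hb⟩ := step3 a
    refine AddSubgroup.mem_map.mpr ⟨TateModule.proj ℓ m b, ?_, ?_⟩
    · exact proj_tateModule_mem_geomTorsion W ℓ m b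
    · rw [AddMonoidHom.sub_apply, AddMonoidHom.id_apply, DistribSMul.toAddMonoidHom_apply,
        ← proj_galoisRepTate_sub, ← hfT_apply, hb, TateModule.proj_pow_smul, ha]
  -- Step 5: counting
  have hℓK' : ∀ n : ℕ, ((ℓ ^ n : ℕ) : AlgebraicClosure K) ≠ 0 := fun n ↦ by
    rw [Nat.cast_pow]
    exact pow_ne_zero n (by
      rw [← map_natCast (algebraMap K (AlgebraicClosure K)) ℓ]
      exact (map_ne_zero_iff _ (algebraMap K _).injective).mpr hℓK)
  have hcardT : ∀ n : ℕ, Nat.card (geomTorsion W ((ℓ ^ n : ℕ) : ℤ)) = (ℓ ^ n) ^ 2 := fun n ↦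
    (W.baseChange (AlgebraicClosure K)).card_torsionBy_eq_sq (hℓK' n)
  -- the multiplication by `ℓᵏ` on `E[ℓᵐ]`
  set φ : geomTorsion W ((ℓ ^ m : ℕ) : ℤ) →+ geomPoints W :=
    AddMonoidHom.mk' (fun P ↦ ℓ ^ k • (P : geomPoints W)) fun a b ↦ by
      rw [AddSubgroup.coe_add, smul_add] with hφ
  have hφapply : ∀ P, φ P = ℓ ^ k • (P : geomPoints W) := fun P ↦ rfl
  haveI hfin : Finite (geomTorsion W ((ℓ ^ m : ℕ) : ℤ)) := by
    apply Nat.finite_of_card_ne_zero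
    rw [hcardT]
    exact pow_ne_zero 2 (pow_ne_zero m hℓ.out.ne_zero)
  -- range φ ≤ H
  have hrange : φ.range ≤ H := by
    rintro Q ⟨P, rfl⟩
    exact step4 P P.2
  haveI : Finite H := by
    have hHfin : (H : Set (geomPoints W)).Finite := by
      rw [hH, AddSubgroup.coe_map]
      exact (Set.toFinite _).image _
    exact hHfin.to_subtype
  have hcard_range_le : Nat.card φ.range ≤ ℓ ^ (m + d) :=
    (Nat.card_mono (Set.toFinite _) hrange).trans (hcard m)
  -- ker φ embeds into `E[ℓᵏ]`
  have hker : Nat.card φ.ker ≤ (ℓ ^ k) ^ 2 := by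
    rw [← hcardT k]
    haveI : Finite (geomTorsion W ((ℓ ^ k : ℕ) : ℤ)) := by
      apply Nat.finite_of_card_ne_zero
      rw [hcardT]
      exact pow_ne_zero 2 (pow_ne_zero k hℓ.out.ne_zero)
    refine Nat.card_le_card_of_injective
      (fun P : φ.ker ↦ (⟨((P : geomTorsion W ((ℓ ^ m : ℕ) : ℤ)) : geomPoints W), ?_⟩ :
        geomTorsion W ((ℓ ^ k : ℕ) : ℤ))) ?_
    · have hP := P.2
      rw [AddMonoidHom.mem_ker, hφapply] at hP
      change ((ℓ ^ k : ℕ) : ℤ) • ((P : geomTorsion W ((ℓ ^ m : ℕ) : ℤ)) : geomPoints W) = 0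
      rw [natCast_zsmul]
      exact hP
    · intro P Q hPQ
      have := congrArg Subtype.val hPQ
      exact Subtype.ext (Subtype.ext this)
  -- `#E[ℓᵐ] = #ker φ · #range φ`
  have hmul : Nat.card (geomTorsion W ((ℓ ^ m : ℕ) : ℤ)) =
      Nat.card φ.ker * Nat.card φ.range := by
    rw [AddSubgroup.card_eq_card_quotient_mul_card_addSubgroup φ.ker, mul_comm,
      Nat.card_congr (QuotientAddGroup.quotientKerEquivRange φ).toEquiv]
  rw [hcardT] at hmul
  -- `ℓ^{2m} ≤ ℓ^{2k} · ℓ^{m + d}` with `m = 2k + d + 1`: contradiction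
  have h1 : (ℓ ^ m) ^ 2 ≤ (ℓ ^ k) ^ 2 * ℓ ^ (m + d) := by
    rw [hmul]; exact Nat.mul_le_mul hker hcard_range_le
  have h2 : (ℓ ^ k) ^ 2 * ℓ ^ (m + d) < (ℓ ^ m) ^ 2 := by
    rw [hm, ← pow_mul, ← pow_add, ← pow_mul]
    exact Nat.pow_lt_pow_right hℓ.out.one_lt (by omega)
  exact absurd h1 (not_le.mpr h2)

/-- **An element with `χ_ℓ(τ) ≠ 1` and `#((τ - 1) E[ℓᵐ]) ≤ ℓ^{m + d}` for all `m` forces the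
scalar commutant** (as `exists_eq_smul_one_of_equivariant_of_card_map_smul_sub_le`, `d = 0`):
`ρ_ℓ(τ) - 1` is non-zero (`det ρ_ℓ(τ) = χ_ℓ(τ)`) and not surjective, so `τ` fixes exactly a line
of the plane `V_ℓ E`, and `exists_eq_smul_one_of_forall_commute_of_fixed_line` applies (Serre
1968, IV.2.2: no element of a non-split Cartan subgroup has the eigenvalue `1` with multiplicity
one). [cite: SerreAbelianLadic1968, IV.2.2] -/
theorem exists_eq_smul_one_of_equivariant_of_card_map_smul_sub_le_pow_add [NumberField K]
    [W.IsElliptic] {τ : Field.absoluteGaloisGroup K} (hχ : GaloisRep.cyclotomicCharacter K ℓ τ ≠ 1)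
    {d : ℕ} (hcard : ∀ m : ℕ, Nat.card ((geomTorsion W ((ℓ ^ m : ℕ) : ℤ)).map
      (DistribSMul.toAddMonoidHom (geomPoints W) τ - AddMonoidHom.id (geomPoints W))) ≤
        ℓ ^ (m + d))
    (hnl : ∀ L : Submodule ℚ_[ℓ] (W.rationalTateModule ℓ),
      (∀ σ : Field.absoluteGaloisGroup K, ∀ v ∈ L, rationalGaloisRepTate W ℓ σ v ∈ L) →
        Module.finrank ℚ_[ℓ] L ≠ 1)
    (G : Module.End ℚ_[ℓ] (W.rationalTateModule ℓ))
    (hG : ∀ (σ : Field.absoluteGaloisGroup K) (v : W.rationalTateModule ℓ),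
      G (rationalGaloisRepTate W ℓ σ v) = rationalGaloisRepTate W ℓ σ (G v)) :
    ∃ c : ℚ_[ℓ], G = c • 1 := by
  have hℓK : (ℓ : K) ≠ 0 := Nat.cast_ne_zero.mpr hℓ.out.ne_zero
  have h2 := finrank_rationalTateModule_eq_two_holds W ℓ hℓK
  haveI : Module.Finite ℚ_[ℓ] (W.rationalTateModule ℓ) := module_finite_rationalTateModule_holds W ℓ
  set f : Module.End ℚ_[ℓ] (W.rationalTateModule ℓ) := rationalGaloisRepTate W ℓ τ - 1 with hf
  have hns : ¬ Function.Surjective f :=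
    not_surjective_rationalGaloisRepTate_sub_one_of_le_pow_add W ℓ hℓK τ d hcard
  have hf0 : f ≠ 0 := fun h0 ↦
    rationalGaloisRepTate_ne_one_of_cyclotomicCharacter_ne_one W ℓ hχ (sub_eq_zero.mp h0)
  have hrange_lt : Module.finrank ℚ_[ℓ] (LinearMap.range f) < 2 := by
    rw [← h2]
    exact Submodule.finrank_lt (mt LinearMap.range_eq_top.mp hns)
  have hrange_pos : 0 < Module.finrank ℚ_[ℓ] (LinearMap.range f) := by
    rw [Module.finrank_pos_iff_exists_ne_zero]
    by_contra hall
    push Not at hall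
    apply hf0
    refine LinearMap.ext fun w ↦ ?_
    have := hall ⟨f w, LinearMap.mem_range_self f w⟩
    rw [Subtype.ext_iff] at this
    exact this
  have hker : Module.finrank ℚ_[ℓ] (LinearMap.ker f) = 1 := by
    have hrn := LinearMap.finrank_range_add_finrank_ker f
    rw [h2] at hrn
    omega
  refine exists_eq_smul_one_of_forall_commute_of_fixed_line h2
    (fun σ ↦ rationalGaloisRepTate W ℓ σ) ({τ} : Set (Field.absoluteGaloisGroup K))
    (L := LinearMap.ker f) (fun w ↦ ?_) hker hnl fun σ ↦ LinearMap.ext fun w ↦ hG σ w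
  simp only [Set.mem_singleton_iff, forall_eq, LinearMap.mem_ker, hf, LinearMap.sub_apply,
    Module.End.one_apply, sub_eq_zero]

/-! ## Non-integral `j`, every prime `ℓ` -/

/-- **The core of Satz 4 at a place `v ∣ ℓ` with `ord_v(j) < 0`, for every prime `ℓ`**
(potentially multiplicative reduction above `ℓ`; `ℓ = 2` allowed): if `V_ℓ E` has no
`Γ_K`-stable line, every `Γ_K`-equivariant endomorphism of `V_ℓ E` is a scalar — through
`exists_cyclotomicCharacter_ne_one_card_map_smul_sub_le_pow_add_two_of_one_lt_valuation_j`
(`#((τ - 1) E[ℓᵐ]) ≤ ℓ^{m + 2}`) and the generic step with slack.  Serre 1968, IV.2.2 with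
A.1.2–A.1.3.  No hypothesis on `End_K(E)`. [cite: SerreAbelianLadic1968, IV.2.2 and A.1.3] -/
theorem exists_eq_smul_one_of_equivariant_of_one_lt_valuation_j_of_mem_asIdeal [NumberField K]
    [W.IsElliptic] {v : HeightOneSpectrum (𝓞 K)} (hℓv : (ℓ : 𝓞 K) ∈ v.asIdeal)
    (hj : 1 < v.valuation K W.j)
    (hnl : ∀ L : Submodule ℚ_[ℓ] (W.rationalTateModule ℓ),
      (∀ σ : Field.absoluteGaloisGroup K, ∀ v ∈ L, rationalGaloisRepTate W ℓ σ v ∈ L) →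
        Module.finrank ℚ_[ℓ] L ≠ 1)
    (G : Module.End ℚ_[ℓ] (W.rationalTateModule ℓ))
    (hG : ∀ (σ : Field.absoluteGaloisGroup K) (v : W.rationalTateModule ℓ),
      G (rationalGaloisRepTate W ℓ σ v) = rationalGaloisRepTate W ℓ σ (G v)) :
    ∃ c : ℚ_[ℓ], G = c • 1 := by
  obtain ⟨τ, hχ, hcard⟩ :=
    W.exists_cyclotomicCharacter_ne_one_card_map_smul_sub_le_pow_add_two_of_one_lt_valuation_j
      hℓv hj
  exact exists_eq_smul_one_of_equivariant_of_card_map_smul_sub_le_pow_add W ℓ hχ hcard hnl G hG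

/-- **The core of Satz 4 for a curve with non-integral `j`, for every prime `ℓ`**: for `E/K`
over a number field with `ord_v(j(E)) < 0` at some finite place `v` (any residue
characteristic), if `V_ℓ E` has no `Γ_K`-stable line then every `Γ_K`-equivariant endomorphism
of `V_ℓ E` is a scalar — `exists_eq_smul_one_of_equivariant_of_one_lt_valuation_j'` (`v ∤ ℓ`,
`FaltingsECEndCoreCasesProofs`) or the previous theorem (`v ∣ ℓ`).  Serre 1968, IV.2.2 for
curves with non-integral `j`. [cite: SerreAbelianLadic1968, IV.2.2, A.1] -/
theorem exists_eq_smul_one_of_equivariant_of_nonintegral_j [NumberField K] [W.IsElliptic]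
    {v : HeightOneSpectrum (𝓞 K)} (hj : 1 < v.valuation K W.j)
    (hnl : ∀ L : Submodule ℚ_[ℓ] (W.rationalTateModule ℓ),
      (∀ σ : Field.absoluteGaloisGroup K, ∀ v ∈ L, rationalGaloisRepTate W ℓ σ v ∈ L) →
        Module.finrank ℚ_[ℓ] L ≠ 1)
    (G : Module.End ℚ_[ℓ] (W.rationalTateModule ℓ))
    (hG : ∀ (σ : Field.absoluteGaloisGroup K) (v : W.rationalTateModule ℓ),
      G (rationalGaloisRepTate W ℓ σ v) = rationalGaloisRepTate W ℓ σ (G v)) :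
    ∃ c : ℚ_[ℓ], G = c • 1 := by
  by_cases hℓv : (ℓ : 𝓞 K) ∈ v.asIdeal
  · exact exists_eq_smul_one_of_equivariant_of_one_lt_valuation_j_of_mem_asIdeal W ℓ hℓv hj hnl G
      hG
  · exact exists_eq_smul_one_of_equivariant_of_one_lt_valuation_j' W ℓ hℓv hj hnl G hG

/-- **The named core fact for a curve with non-integral `j`, every prime `ℓ`**:
`exists_eq_smul_one_of_equivariant_of_not_hasRationalCM W ℓ` holds whenever `ord_v(j(E)) < 0` at
some finite place `v` of `K` — the hypothesis `End_K(E) = ℤ` being superfluous.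
[cite: Faltings1983Endlichkeit, §5 Satz 4 (⊗ ℚ_ℓ form; case of non-integral j)]
[cite: SerreAbelianLadic1968, IV.2.2] -/
theorem exists_eq_smul_one_of_equivariant_of_not_hasRationalCM_of_nonintegral_j
    {v : HeightOneSpectrum (𝓞 K)} [NumberField K] [W.IsElliptic] (hj : 1 < v.valuation K W.j) :
    exists_eq_smul_one_of_equivariant_of_not_hasRationalCM W ℓ := by
  intro _ _ _ hnl G hG
  exact exists_eq_smul_one_of_equivariant_of_nonintegral_j W ℓ hj hnl G hG

/-- **Faltings' Satz 4 for an elliptic curve with non-integral `j`** (unconditional; every prime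
`ℓ`): the named fact `mem_span_range_tateEndRingHom_iff W ℓ` (`End_K(E) ⊗ ℤ_ℓ ≅ End_{Γ_K}(T_ℓ E)`).
[cite: Faltings1983Endlichkeit, §5 Satz 4 (case of non-integral j)] -/
theorem mem_span_range_tateEndRingHom_iff_of_nonintegral_j {v : HeightOneSpectrum (𝓞 K)}
    [NumberField K] [W.IsElliptic] (hj : 1 < v.valuation K W.j) :
    mem_span_range_tateEndRingHom_iff W ℓ := by
  intro _ _
  exact mem_span_range_tateEndRingHom_iff_of_isogenyClass_of_core W ℓ (finite_isogenyClass_holds W)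
    (exists_eq_smul_one_of_equivariant_of_not_hasRationalCM_of_nonintegral_j W ℓ hj)

/-- **Faltings' subspace statement for `E × E`, `E` with non-integral `j`** (unconditional;
every prime `ℓ`): the named fact `stable_subspace_prod_eq_range W ℓ` of `FaltingsECSubspaces`.
[cite: Faltings1983Endlichkeit, §5, Sätze 3–4 (case of non-integral j)] -/
theorem stable_subspace_prod_eq_range_of_nonintegral_j {v : HeightOneSpectrum (𝓞 K)}
    [NumberField K] [W.IsElliptic] (hj : 1 < v.valuation K W.j) :
    stable_subspace_prod_eq_range W ℓ := by
  intro _ _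
  exact stable_subspace_prod_eq_range_of_core W ℓ
    (exists_eq_smul_one_of_equivariant_of_not_hasRationalCM_of_nonintegral_j W ℓ hj)

/-- **Faltings' Korollar 1 for `(E, E)`, `E` with non-integral `j`** (unconditional; every
prime `ℓ`): the named fact `mem_span_range_tateModule_map_of_equivariant W W ℓ`.
[cite: Faltings1983Endlichkeit, §5 Satz 4, Korollar 1 (case of non-integral j)] -/
theorem mem_span_range_tateModule_map_of_equivariant_self_of_nonintegral_j
    {v : HeightOneSpectrum (𝓞 K)} [NumberField K] [W.IsElliptic] (hj : 1 < v.valuation K W.j) :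
    mem_span_range_tateModule_map_of_equivariant W W ℓ := by
  intro _ _ _
  exact mem_span_range_tateModule_map_of_equivariant_self_of_isogenyClass_of_core W ℓ
    (finite_isogenyClass_holds W)
    (exists_eq_smul_one_of_equivariant_of_not_hasRationalCM_of_nonintegral_j W ℓ hj)

/-! ## `ℓ = 2`: a place of good ordinary reduction above `2` -/

/-- **The core of Satz 4 at a place `v ∣ 2` of good ordinary reduction** (`ℓ = 2`): for `E/K`
over a number field with a good model `M/𝓞_v` at `v ∣ 2` whose Hasse invariant `a₁(M)` is a
unit, if `V₂ E` has no `Γ_K`-stable line then every `Γ_K`-equivariant endomorphism of `V₂ E` is a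
scalar (`card_map_smul_sub_geomTorsion_le_two_pow` of `KernelReductionOrdinaryTwoProofs`, an
inertia element with `χ₂ ≠ 1`, and the generic step). Serre 1968, IV.2.2 with A.2.2 at `ℓ = 2`.
[cite: SerreAbelianLadic1968, IV.2.2 and A.2.2] -/
theorem exists_eq_smul_one_of_equivariant_of_isUnit_a₁ [NumberField K] [W.IsElliptic]
    {v : HeightOneSpectrum (𝓞 K)} (h2v : (2 : 𝓞 K) ∈ v.asIdeal)
    {C : VariableChange (v.adicCompletion K)} {M : WeierstrassCurve (v.adicCompletionIntegers K)}
    (hCM : C • W.baseChange (v.adicCompletion K) =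
      M.map (algebraMap (v.adicCompletionIntegers K) (v.adicCompletion K))) (hΔ : IsUnit M.Δ)
    (hA : IsUnit M.a₁)
    (hnl : ∀ L : Submodule ℚ_[2] (W.rationalTateModule 2),
      (∀ σ : Field.absoluteGaloisGroup K, ∀ v ∈ L, rationalGaloisRepTate W 2 σ v ∈ L) →
        Module.finrank ℚ_[2] L ≠ 1)
    (G : Module.End ℚ_[2] (W.rationalTateModule 2))
    (hG : ∀ (σ : Field.absoluteGaloisGroup K) (v : W.rationalTateModule 2),
      G (rationalGaloisRepTate W 2 σ v) = rationalGaloisRepTate W 2 σ (G v)) :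
    ∃ c : ℚ_[2], G = c • 1 := by
  obtain ⟨𝔓, h𝔓⟩ := HeightOneSpectrum.primesAbove_nonempty v
  have h2v' : ((2 : ℕ) : 𝓞 K) ∈ v.asIdeal := by simpa using h2v
  obtain ⟨τ, hτ, hχ⟩ := exists_mem_inertia_cyclotomicCharacter_ne_one 2 h2v' h𝔓
  exact exists_eq_smul_one_of_equivariant_of_card_map_smul_sub_le W 2 hχ
    (fun m ↦ W.card_map_smul_sub_geomTorsion_le_two_pow h2v hCM hΔ hA h𝔓 hτ m) hnl G hG

/-- **The named core fact at `ℓ = 2` for a curve with a good ordinary place above `2`.**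
[cite: Faltings1983Endlichkeit, §5 Satz 4 (⊗ ℚ₂ form; ordinary place above 2)]
[cite: SerreAbelianLadic1968, IV.2.2 and A.2.2] -/
theorem exists_eq_smul_one_of_equivariant_of_not_hasRationalCM_of_isUnit_a₁ [NumberField K]
    {v : HeightOneSpectrum (𝓞 K)} (h2v : (2 : 𝓞 K) ∈ v.asIdeal)
    {C : VariableChange (v.adicCompletion K)} {M : WeierstrassCurve (v.adicCompletionIntegers K)}
    (hCM : C • W.baseChange (v.adicCompletion K) =
      M.map (algebraMap (v.adicCompletionIntegers K) (v.adicCompletion K))) (hΔ : IsUnit M.Δ)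
    (hA : IsUnit M.a₁) : exists_eq_smul_one_of_equivariant_of_not_hasRationalCM W 2 := by
  intro _ _ _ hnl G hG
  exact exists_eq_smul_one_of_equivariant_of_isUnit_a₁ W h2v hCM hΔ hA hnl G hG

/-- **Faltings' Satz 4 at `ℓ = 2` for a curve with a good ordinary place above `2`**
(unconditional): the named fact `mem_span_range_tateEndRingHom_iff W 2`.
[cite: Faltings1983Endlichkeit, §5 Satz 4 (ordinary place above 2)] -/
theorem mem_span_range_tateEndRingHom_iff_of_isUnit_a₁ [NumberField K]
    {v : HeightOneSpectrum (𝓞 K)} (h2v : (2 : 𝓞 K) ∈ v.asIdeal)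
    {C : VariableChange (v.adicCompletion K)} {M : WeierstrassCurve (v.adicCompletionIntegers K)}
    (hCM : C • W.baseChange (v.adicCompletion K) =
      M.map (algebraMap (v.adicCompletionIntegers K) (v.adicCompletion K))) (hΔ : IsUnit M.Δ)
    (hA : IsUnit M.a₁) : mem_span_range_tateEndRingHom_iff W 2 := by
  intro _ _
  exact mem_span_range_tateEndRingHom_iff_of_isogenyClass_of_core W 2 (finite_isogenyClass_holds W)
    (exists_eq_smul_one_of_equivariant_of_not_hasRationalCM_of_isUnit_a₁ W h2v hCM hΔ hA)

/-- **Faltings' subspace statement for `E × E` at `ℓ = 2` for a curve with a good ordinary place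
above `2`** (unconditional): the named fact `stable_subspace_prod_eq_range W 2`.
[cite: Faltings1983Endlichkeit, §5, Sätze 3–4 (ordinary place above 2)] -/
theorem stable_subspace_prod_eq_range_of_isUnit_a₁ [NumberField K]
    {v : HeightOneSpectrum (𝓞 K)} (h2v : (2 : 𝓞 K) ∈ v.asIdeal)
    {C : VariableChange (v.adicCompletion K)} {M : WeierstrassCurve (v.adicCompletionIntegers K)}
    (hCM : C • W.baseChange (v.adicCompletion K) =
      M.map (algebraMap (v.adicCompletionIntegers K) (v.adicCompletion K))) (hΔ : IsUnit M.Δ)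
    (hA : IsUnit M.a₁) : stable_subspace_prod_eq_range W 2 := by
  intro _ _
  exact stable_subspace_prod_eq_range_of_core W 2
    (exists_eq_smul_one_of_equivariant_of_not_hasRationalCM_of_isUnit_a₁ W h2v hCM hΔ hA)

/-- **Faltings' Korollar 1 for `(E, E)` at `ℓ = 2` for a curve with a good ordinary place above
`2`** (unconditional): the named fact `mem_span_range_tateModule_map_of_equivariant W W 2`.
[cite: Faltings1983Endlichkeit, §5 Satz 4, Korollar 1 (ordinary place above 2)] -/
theorem mem_span_range_tateModule_map_of_equivariant_self_of_isUnit_a₁ [NumberField K]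
    {v : HeightOneSpectrum (𝓞 K)} (h2v : (2 : 𝓞 K) ∈ v.asIdeal)
    {C : VariableChange (v.adicCompletion K)} {M : WeierstrassCurve (v.adicCompletionIntegers K)}
    (hCM : C • W.baseChange (v.adicCompletion K) =
      M.map (algebraMap (v.adicCompletionIntegers K) (v.adicCompletion K))) (hΔ : IsUnit M.Δ)
    (hA : IsUnit M.a₁) : mem_span_range_tateModule_map_of_equivariant W W 2 := by
  intro _ _ _
  exact mem_span_range_tateModule_map_of_equivariant_self_of_isogenyClass_of_core W 2
    (finite_isogenyClass_holds W)
    (exists_eq_smul_one_of_equivariant_of_not_hasRationalCM_of_isUnit_a₁ W h2v hCM hΔ hA)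

/-- **The named core fact at `ℓ = 2` for a curve acquiring a good ordinary place above `2` over a
finite extension `L/K`** (descent along `L/K`, `FaltingsECEndCoreBaseChangeProofs`).
[cite: SerreAbelianLadic1968, IV.2.2 and A.2.2] -/
theorem exists_eq_smul_one_of_equivariant_of_not_hasRationalCM_of_isUnit_a₁_of_extension
    (L : Type u) [Field L] [NumberField L] [Algebra K L] {w : HeightOneSpectrum (𝓞 L)}
    (h2w : (2 : 𝓞 L) ∈ w.asIdeal)
    {C : VariableChange (w.adicCompletion L)} {M : WeierstrassCurve (w.adicCompletionIntegers L)}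
    (hCM : C • (W.baseChange L).baseChange (w.adicCompletion L) =
      M.map (algebraMap (w.adicCompletionIntegers L) (w.adicCompletion L))) (hΔ : IsUnit M.Δ)
    (hA : IsUnit M.a₁) : exists_eq_smul_one_of_equivariant_of_not_hasRationalCM W 2 := by
  refine exists_eq_smul_one_of_equivariant_of_not_hasRationalCM_of_extension W 2 L ?_
  intro _ _ hnl' G' hG'
  exact exists_eq_smul_one_of_equivariant_of_isUnit_a₁ (W.baseChange L) h2w hCM hΔ hA hnl' G' hG'

/-- **The subspace statement for `E × E` at `ℓ = 2` for a curve acquiring a good ordinary place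
above `2` over a finite extension** (unconditional): `stable_subspace_prod_eq_range W 2`.
[cite: Faltings1983Endlichkeit, §5, Sätze 3–4 (potentially ordinary place above 2)] -/
theorem stable_subspace_prod_eq_range_of_isUnit_a₁_of_extension
    (L : Type u) [Field L] [NumberField L] [Algebra K L] {w : HeightOneSpectrum (𝓞 L)}
    (h2w : (2 : 𝓞 L) ∈ w.asIdeal)
    {C : VariableChange (w.adicCompletion L)} {M : WeierstrassCurve (w.adicCompletionIntegers L)}
    (hCM : C • (W.baseChange L).baseChange (w.adicCompletion L) =
      M.map (algebraMap (w.adicCompletionIntegers L) (w.adicCompletion L))) (hΔ : IsUnit M.Δ)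
    (hA : IsUnit M.a₁) : stable_subspace_prod_eq_range W 2 :=
  stable_subspace_prod_eq_range_of_core W 2
    (exists_eq_smul_one_of_equivariant_of_not_hasRationalCM_of_isUnit_a₁_of_extension W L h2w hCM
      hΔ hA)

/-! ## The frontier -/

/-- **What is left of the core fact**, for every prime `ℓ`, after the real-place,
multiplicative, non-integral-`j`, potential-CM and (potentially) ordinary cases: over a number
field, `exists_eq_smul_one_of_equivariant_of_not_hasRationalCM W ℓ` reduces to the case
`¬ HasCM`, `K` totally imaginary, `j(E) ∈ 𝓞_K` (`ord_v(j) ≥ 0` at every finite place: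
potentially good reduction everywhere), and no finite extension `L/K` has a place `w ∣ ℓ` with a
good model `M` of `E_L` over `𝓞_w` whose Hasse invariant — `a₁(M)` if `ℓ = 2`, `A_ℓ(M)`
(`hasseCoeff`) if `ℓ` is odd — is a unit; i.e. `E` has potentially good **supersingular**
reduction at every place above `ℓ`.  There Serre's theorem needs the Hodge–Tate decomposition
(1968, IV.2.2 via III and A.2.3–A.2.4), or Faltings' Finiteness I
(`AbelianVariety.finite_isoClasses_isogenous`).
[cite: SerreAbelianLadic1968, IV.2.2] [cite: Faltings1983Endlichkeit, §5 Satz 4] -/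
theorem exists_eq_smul_one_of_equivariant_of_not_hasRationalCM_of_residual_supersingular
    [NumberField K] [W.IsElliptic]
    (h : ¬ W.HasCM → IsEmpty (K →+* ℝ) →
      (∀ v : HeightOneSpectrum (𝓞 K), v.valuation K W.j ≤ 1) →
      (∀ (L : Type u) [Field L] [NumberField L] [Algebra K L]
          (w : HeightOneSpectrum (𝓞 L)) (C : VariableChange (w.adicCompletion L))
          (M : WeierstrassCurve (w.adicCompletionIntegers L)), (ℓ : 𝓞 L) ∈ w.asIdeal →
          C • (W.baseChange L).baseChange (w.adicCompletion L) =
            M.map (algebraMap (w.adicCompletionIntegers L) (w.adicCompletion L)) →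
          IsUnit M.Δ → ¬ IsUnit (if ℓ = 2 then M.a₁ else M.hasseCoeff ℓ)) →
      exists_eq_smul_one_of_equivariant_of_not_hasRationalCM W ℓ) :
    exists_eq_smul_one_of_equivariant_of_not_hasRationalCM W ℓ := by
  refine exists_eq_smul_one_of_equivariant_of_not_hasRationalCM_of_residual'' W ℓ
    fun hCM hR _ hord ↦ ?_
  -- non-integral `j` is settled for every `ℓ`
  by_cases hint : ∀ v : HeightOneSpectrum (𝓞 K), v.valuation K W.j ≤ 1
  swap
  · push Not at hint
    obtain ⟨v, hv⟩ := hint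
    exact exists_eq_smul_one_of_equivariant_of_not_hasRationalCM_of_nonintegral_j W ℓ hv
  by_cases hℓ2 : ℓ = 2
  · -- `ℓ = 2`: either a (potentially) ordinary good place above `2` exists, or `h` applies
    by_cases hord2 : ∀ (L : Type u) [Field L] [NumberField L] [Algebra K L]
        (w : HeightOneSpectrum (𝓞 L)) (C : VariableChange (w.adicCompletion L))
        (M : WeierstrassCurve (w.adicCompletionIntegers L)), (ℓ : 𝓞 L) ∈ w.asIdeal →
        C • (W.baseChange L).baseChange (w.adicCompletion L) =
          M.map (algebraMap (w.adicCompletionIntegers L) (w.adicCompletion L)) →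
        IsUnit M.Δ → ¬ IsUnit M.a₁
    · refine h hCM hR hint fun L _ _ _ w C M hℓw hCM' hΔ ↦ ?_
      rw [if_pos hℓ2]
      exact hord2 L w C M hℓw hCM' hΔ
    · push Not at hord2
      obtain ⟨L, _, _, _, w, C, M, hℓw, hCM', hΔ, hA⟩ := hord2
      subst hℓ2
      have h2w : (2 : 𝓞 L) ∈ w.asIdeal := by exact_mod_cast hℓw
      exact exists_eq_smul_one_of_equivariant_of_not_hasRationalCM_of_isUnit_a₁_of_extension W L
        h2w hCM' hΔ hA
  · -- `ℓ` odd: `hord` is the absence of potentially ordinary places above `ℓ`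
    refine h hCM hR hint fun L _ _ _ w C M hℓw hCM' hΔ ↦ ?_
    rw [if_neg hℓ2]
    exact hord.resolve_left hℓ2 L w C M hℓw hCM' hΔ

end Literature.AlgebraicGeometry.Motives
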